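import Summits.ABC.ABC.Theses.CubicResolventAllowance
import Summits.ABC.ABC.Theorems.CubicResolventAllowanceResolventDiscBoundsCaps
import Literature.NumberTheory.EllipticCurves.DivisionField
import Literature.NumberTheory.EllipticCurves.DivisionFieldSelfRamificationProofs
import Literature.NumberTheory.EllipticCurves.TwoTorsionGaloisActionProofs
import Literature.NumberTheory.EllipticCurves.BSDConductorProofs
import Literature.NumberTheory.Automorphic.BCDTModularitySemistableTwistProofs
import Literature.NumberTheory.DiophantineGeometry.Conductor
import HarnessLib

/-!
# Route CubicResolventAllowance — item `ResolventDiscBounds` (stmt-ABC-22743), part II: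
# the 2-division field is unramified away from `2N`, and the resolvent discriminant bounds

For an elliptic curve `E/ℚ` (a Weierstrass model `W` over `ℚ`) with conductor `N = W.conductorNorm ℤ`:

* `not_dvd_discr_divisionField_two`: an odd prime `p ∤ N` does not divide the discriminant of the
  2-division field `ℚ(E[2])` (Néron–Ogg–Shafarevich, easy half — the tree's
  `WeierstrassCurve.ramificationIdx_divisionField_eq_one_of_hasGoodReductionAt` — with
  `p ∤ N ⇒` good reduction, and Dedekind's criterion `p ∣ d ⟺ p` ramified);
* `exists_ringHom_divisionField_two`: a number field `K = ℚ(θ)` generated by a root of the 2-division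
  cubic `4x³ + b₂x² + 2b₄x + b₆` embeds into `ℚ(E[2])` (the roots are the abscissae of the nonzero
  2-torsion points);
* `resolventDiscBounds_proof`: `|d_K| ≤ 1944·N²` for a cubic field containing a root of the
  irreducible 2-division cubic and `|d_K| ≤ 8·N` for a quadratic field generated by an irrational root
  — from `d_K ∣ d_{ℚ(E[2])}` (Mathlib `NumberField.discr_dvd_discr`), the support statement above,
  and the valuation caps of part I (`padicValNat_discr_le_of_finrank_lt`,
  `padicValNat_two_discr_le_three`, `padicValNat_three_discr_le_five`).

All inputs are tree/Mathlib theorems; no named fact, no conjecture. A-PS is NOT abc.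

References: J. H. Silverman, *The Arithmetic of Elliptic Curves* (2009), VII.4.1 and VII.7.1
(Néron–Ogg–Shafarevich), VIII.§1; J. Neukirch, *Algebraic Number Theory* (1999), III (2.6), (2.9).
-/

-- `Summit.<Summit>.<Problem>` is the mandated summit-side namespace (CONVENTIONS §2); for the
-- single-conjunct summit `ABC` the two coincide, so the duplicate `ABC.ABC` is deliberate.
set_option linter.dupNamespace false

noncomputable section

namespace Summit.ABC.ABC.Theorems

open NumberField IsDedekindDomain Ideal Polynomial
open WeierstrassCurve Literature.NumberTheory.EllipticCurves
open scoped Classical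

/-! ### §A. `ℚ(E[2])` is unramified at odd primes of good reduction -/

section DivisionField

variable (W : WeierstrassCurve ℚ) [W.IsElliptic]

/-- `ℚ(E[2])` is a number field. [cite: SilvermanAEC2009, VIII.§1 (action of G_{K̄/K} on E[m])] -/
theorem numberField_divisionField_two : NumberField (W.divisionField 2) :=
  NumberField.of_module_finite ℚ (W.divisionField 2)

/-- **An odd prime `p ∤ N_E` does not divide the discriminant of `ℚ(E[2])`.** Every prime `P` of
`𝓞_{ℚ(E[2])}` above `p` has `e(P|p) = 1` (Néron–Ogg–Shafarevich for `E[2]` at a place of good reduction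
not above `2`, the tree's `ramificationIdx_divisionField_eq_one_of_hasGoodReductionAt`; good reduction
from `p ∤ N`, `hasGoodReductionAt_ringOfIntegers_of_not_dvd_conductorNorm`), hence `P ∤ 𝔇` and
`p ∤ d` (Mathlib `NumberField.not_dvd_discr_iff_forall_mem`). [cite: SilvermanAEC2009, Thm. VII.7.1] -/
theorem not_dvd_discr_divisionField_two {p : ℕ} (hp : p.Prime) (hp2 : p ≠ 2)
    (hpN : ¬ p ∣ W.conductorNorm ℤ) :
    haveI := numberField_divisionField_two W
    ¬ (p : ℤ) ∣ NumberField.discr (W.divisionField 2) := by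
  haveI := numberField_divisionField_two W
  set D := W.divisionField 2 with hD
  rw [NumberField.not_dvd_discr_iff_forall_mem D (𝓞 D) (Nat.prime_iff_prime_int.mp hp)]
  intro P hP hpP
  -- `P` is a maximal ideal of `𝓞 D` containing `p`
  have hpP' : (p : 𝓞 D) ∈ P := by simpa using hpP
  have hP0 : P ≠ ⊥ := fun h => by
    rw [h, Ideal.mem_bot, Nat.cast_eq_zero] at hpP'
    exact hp.ne_zero hpP'
  haveI : P.IsMaximal := hP.isMaximal hP0
  -- the place `v` of `𝓞 ℚ` below `P`
  haveI : (P.under (𝓞 ℚ)).IsPrime := Ideal.IsPrime.under (𝓞 ℚ) P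
  have hv0 : P.under (𝓞 ℚ) ≠ ⊥ := Ideal.under_ne_bot (𝓞 ℚ) hP0
  let v : HeightOneSpectrum (𝓞 ℚ) := ⟨P.under (𝓞 ℚ), inferInstance, hv0⟩
  haveI : P.LiesOver v.asIdeal := ⟨rfl⟩
  have hpv : (p : 𝓞 ℚ) ∈ v.asIdeal := by
    change (p : 𝓞 ℚ) ∈ P.under (𝓞 ℚ)
    rw [Ideal.mem_comap, map_natCast]
    exact hpP'
  have hveq : v = Rat.HeightOneSpectrum.primesEquiv.symm ⟨p, hp⟩ :=
    (natCast_mem_asIdeal_iff_eq_primesEquiv_symm v hp).mp hpv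
  have hgood : W.HasGoodReductionAt v := by
    refine Literature.NumberTheory.Automorphic.BCDT.hasGoodReductionAt_ringOfIntegers_of_not_dvd_conductorNorm
      W v ?_
    rw [hveq, Equiv.apply_symm_apply]
    exact hpN
  have h2v : ((2 : ℕ) : 𝓞 ℚ) ∉ v.asIdeal := by
    intro h2
    have := (natCast_mem_asIdeal_iff_eq_primesEquiv_symm v Nat.prime_two).mp h2
    rw [hveq] at this
    have := congrArg (fun q : Nat.Primes => (q : ℕ)) (Rat.HeightOneSpectrum.primesEquiv.symm.injective this)
    exact hp2 this
  have he : P.ramificationIdx (𝓞 ℚ) = 1 :=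
    @WeierstrassCurve.ramificationIdx_divisionField_self_eq_one_of_hasGoodReductionAt ℚ _ _ W _ 2 v
      hgood h2v P _ ⟨rfl⟩
  rw [ramificationIdx_ringOfIntegers_rat_eq D P] at he
  have hmult := multiplicity_differentIdeal_int_eq_zero_of_ramificationIdx_eq_one D P he
  rw [multiplicity_eq_zero] at hmult
  exact not_dvd_differentIdeal_iff.mp hmult

end DivisionField

/-! ### §B. Roots of the 2-division cubic lie in `ℚ(E[2])`; generated fields embed -/

section Embedding

open Literature.NumberTheory.EllipticCurves.DokchitserDokchitser2012

variable (W : WeierstrassCurve ℚ) [W.IsElliptic]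

omit [W.IsElliptic] in
/-- The 2-division cubic of the base change to `ℚ̄` is the base change of the 2-division cubic.
[folklore] -/
theorem twoTorsionPolynomial_baseChange_toPoly :
    (W.baseChange (AlgebraicClosure ℚ)).twoTorsionPolynomial.toPoly =
      W.twoTorsionPolynomial.toPoly.map (algebraMap ℚ (AlgebraicClosure ℚ)) := by
  rw [← Cubic.map_toPoly]
  congr 1
  simp only [WeierstrassCurve.twoTorsionPolynomial, Cubic.map, WeierstrassCurve.baseChange,
    WeierstrassCurve.map_b₂, WeierstrassCurve.map_b₄, WeierstrassCurve.map_b₆, map_ofNat, map_mul]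

omit [W.IsElliptic] in
/-- A nonzero geometric point is an affine point `(x, y)`. [folklore] -/
theorem exists_eq_some_of_ne_zero {P : geomPoints W} (hP : P ≠ 0) :
    ∃ (x y : AlgebraicClosure ℚ) (h : (W.baseChange (AlgebraicClosure ℚ)).toAffine.Nonsingular x y),
      P = Affine.Point.some x y h := by
  change (W.baseChange (AlgebraicClosure ℚ)).toAffine.Point at P
  rcases P with _ | ⟨x, y, h⟩
  · exact absurd rfl hP
  · exact ⟨x, y, h, rfl⟩

/-- **Every root in `ℚ̄` of the 2-division cubic `4x³ + b₂x² + 2b₄x + b₆` is the abscissa `x(T_i)` of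
one of the three nonzero 2-torsion points** (the three distinct abscissae are roots, and a cubic has
at most three roots). [cite: SilvermanAEC2009, Ex. III.3.7 (d) (ψ₂² = 4x³ + b₂x² + 2b₄x + b₆ vanishes exactly on E[2] ∖ O)] -/
theorem exists_xT_eq_of_aeval_eq_zero {α : AlgebraicClosure ℚ}
    (hα : Polynomial.aeval α W.twoTorsionPolynomial.toPoly = 0) :
    ∃ i : Fin 3, xT W two_ne_zero i = α := by
  set g := (W.baseChange (AlgebraicClosure ℚ)).twoTorsionPolynomial.toPoly with hg
  have ha : (W.baseChange (AlgebraicClosure ℚ)).twoTorsionPolynomial.a ≠ 0 := by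
    simp [WeierstrassCurve.twoTorsionPolynomial]
  have hg0 : g ≠ 0 := Cubic.ne_zero_of_a_ne_zero ha
  have hdeg : g.natDegree = 3 := Cubic.natDegree_of_a_ne_zero ha
  have hαroot : α ∈ g.roots := by
    rw [Polynomial.mem_roots hg0, hg, twoTorsionPolynomial_baseChange_toPoly, Polynomial.IsRoot,
      Polynomial.eval_map, ← Polynomial.aeval_def]
    exact hα
  have hsub : Finset.univ.image (xT W two_ne_zero) ⊆ g.roots.toFinset := by
    intro x hx
    obtain ⟨i, -, rfl⟩ := Finset.mem_image.mp hx
    rw [Multiset.mem_toFinset, Polynomial.mem_roots hg0]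
    exact isRoot_xco_of_add_self_eq_zero W (coe_T_ne_zero W two_ne_zero i)
      (coe_add_self_eq_zero W _)
  have hcard : g.roots.toFinset.card ≤ (Finset.univ.image (xT W two_ne_zero)).card := by
    rw [Finset.card_image_of_injective _ (xT_injective W two_ne_zero), Finset.card_univ,
      Fintype.card_fin]
    exact (Multiset.toFinset_card_le _).trans ((Polynomial.card_roots' g).trans hdeg.le)
  have heq := Finset.eq_of_subset_of_card_le hsub hcard
  have hmem : α ∈ Finset.univ.image (xT W two_ne_zero) := by
    rw [heq, Multiset.mem_toFinset]
    exact hαroot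
  obtain ⟨i, -, hi⟩ := Finset.mem_image.mp hmem
  exact ⟨i, hi⟩

/-- **The roots of the 2-division cubic lie in the 2-division field `ℚ(E[2])`** (they are abscissae
of 2-torsion points, whose coordinates lie in `ℚ(E[2])`: the tree's `mem_divisionField_of_eq_some`).
[cite: SilvermanAEC2009, VIII.§1 (action of G_{K̄/K} on E[m])] -/
theorem mem_divisionField_two_of_aeval_eq_zero {α : AlgebraicClosure ℚ}
    (hα : Polynomial.aeval α W.twoTorsionPolynomial.toPoly = 0) : α ∈ W.divisionField 2 := by
  obtain ⟨i, rfl⟩ := exists_xT_eq_of_aeval_eq_zero W hα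
  obtain ⟨x, y, h, hT⟩ := exists_eq_some_of_ne_zero W (coe_T_ne_zero W two_ne_zero i)
  have hx : xT W two_ne_zero i = x := by
    simp only [xT, hT, xco]
  rw [hx]
  exact (W.mem_divisionField_of_eq_some 2 hT).1

/-- **A number field `K = ℚ(θ)` generated by a root `θ` of the 2-division cubic embeds into
`ℚ(E[2])`**: any `ℚ`-embedding `K → ℚ̄` sends `θ` to a root, which lies in `ℚ(E[2])`, and the image
of `K = ℚ(θ)` is `ℚ(image of θ)`. [cite: SilvermanAEC2009, VIII.§1 (action of G_{K̄/K} on E[m])] -/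
theorem exists_ringHom_divisionField_two (K : Type*) [Field K] [NumberField K] {θ : K}
    (hθ : Polynomial.aeval θ W.twoTorsionPolynomial.toPoly = 0)
    (hgen : IntermediateField.adjoin ℚ {θ} = ⊤) :
    Nonempty (K →+* W.divisionField 2) := by
  let φ : K →ₐ[ℚ] AlgebraicClosure ℚ := IsAlgClosed.lift
  have hφθ : Polynomial.aeval (φ θ) W.twoTorsionPolynomial.toPoly = 0 := by
    rw [Polynomial.aeval_algHom_apply, hθ, map_zero]
  have hmem : φ θ ∈ W.divisionField 2 := mem_divisionField_two_of_aeval_eq_zero W hφθ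
  have h1 : φ.fieldRange ≤ W.divisionField 2 := by
    rw [AlgHom.fieldRange_eq_map, ← hgen, IntermediateField.adjoin_map, Set.image_singleton,
      IntermediateField.adjoin_simple_le_iff]
    exact hmem
  have hrange : ∀ x : K, φ x ∈ W.divisionField 2 := fun x => h1 (AlgHom.mem_fieldRange.mpr ⟨x, rfl⟩)
  exact ⟨{ toFun := fun x => ⟨φ x, hrange x⟩,
           map_one' := Subtype.ext (map_one φ),
           map_mul' := fun x y => Subtype.ext (map_mul φ x y),
           map_zero' := Subtype.ext (map_zero φ),
           map_add' := fun x y => Subtype.ext (map_add φ x y) }⟩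

end Embedding

/-! ### §C. Assembly: `d_K ∣ 1944·N²` (cubic), `d_K ∣ 8·N` (quadratic) -/

section Assembly

variable (W : WeierstrassCurve ℚ) [W.IsElliptic]

/-- **Support and caps ⇒ divisibility.** If `K` (of degree `≤ 3`) embeds in `ℚ(E[2])` then every
prime `p ≥ 5` dividing `d_K` divides `N`; with the caps of part I this gives, prime by prime,
`|d_K| ∣ 2³·3⁵·N²` when `[K:ℚ] = 3`. [cite: SilvermanAEC2009, Thm. VII.7.1] -/
theorem natAbs_discr_dvd_of_cubic (K : Type*) [Field K] [NumberField K]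
    (hK : Module.finrank ℚ K = 3) (ψ : K →+* W.divisionField 2) :
    (NumberField.discr K).natAbs ∣ 1944 * (W.conductorNorm ℤ) ^ 2 := by
  haveI := numberField_divisionField_two W
  letI : Algebra K (W.divisionField 2) := ψ.toAlgebra
  have hdvd : NumberField.discr K ∣ NumberField.discr (W.divisionField 2) :=
    NumberField.discr_dvd_discr K (W.divisionField 2)
  have hd0 : (NumberField.discr K).natAbs ≠ 0 := Int.natAbs_ne_zero.mpr (NumberField.discr_ne_zero K)
  have hN0 : W.conductorNorm ℤ ≠ 0 := (W.conductorNorm_pos_holds).ne'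
  have hM : (1944 : ℕ) * W.conductorNorm ℤ ^ 2 = 2 ^ 3 * 3 ^ 5 * W.conductorNorm ℤ ^ 2 := by
    norm_num
  rw [hM, ← Nat.factorization_prime_le_iff_dvd hd0 (by positivity)]
  intro p hp
  rw [Nat.factorization_mul (by positivity) (by positivity), Nat.factorization_mul (by positivity)
    (by positivity), Nat.factorization_pow, Nat.factorization_pow, Nat.factorization_pow,
    Nat.Prime.factorization Nat.prime_two, Nat.Prime.factorization Nat.prime_three]
  simp only [Finsupp.coe_add, Finsupp.coe_smul, Pi.add_apply, Pi.smul_apply, smul_eq_mul,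
    Finsupp.single_apply]
  rw [Nat.factorization_def _ hp]
  by_cases h2 : p = 2
  · subst h2
    have := padicValNat_two_discr_le_three K hK.le
    simp only [if_true, show (3 : ℕ) ≠ 2 by norm_num, if_false, mul_zero, add_zero]
    omega
  by_cases h3 : p = 3
  · subst h3
    have := padicValNat_three_discr_le_five K hK.le
    simp only [if_true, show (2 : ℕ) ≠ 3 by norm_num, if_false, mul_zero, zero_add]
    omega
  have h5 : 5 ≤ p := by
    by_contra hlt
    have := hp.two_le
    interval_cases p
    · exact h2 rfl
    · exact h3 rfl
    · exact absurd hp (by decide)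
  simp only [show (2 : ℕ) ≠ p from fun h => h2 h.symm, show (3 : ℕ) ≠ p from fun h => h3 h.symm,
    if_false, mul_zero, zero_add]
  by_cases hpN : p ∣ W.conductorNorm ℤ
  · have hcap := padicValNat_discr_le_of_finrank_lt K hp (by omega)
    rw [hK] at hcap
    have := hp.factorization_pos_of_dvd hN0 hpN
    omega
  · have hnd : ¬ (p : ℤ) ∣ NumberField.discr K := fun h =>
      not_dvd_discr_divisionField_two W hp h2 hpN (h.trans hdvd)
    have : ¬ p ∣ (NumberField.discr K).natAbs := fun h => hnd (Int.natCast_dvd.mpr h)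
    rw [padicValNat.eq_zero_of_not_dvd this]
    exact Nat.zero_le _

/-- The quadratic analogue: if `K` of degree `2` embeds in `ℚ(E[2])` then `|d_K| ∣ 8·N`.
[cite: SilvermanAEC2009, Thm. VII.7.1] -/
theorem natAbs_discr_dvd_of_quadratic (K : Type*) [Field K] [NumberField K]
    (hK : Module.finrank ℚ K = 2) (ψ : K →+* W.divisionField 2) :
    (NumberField.discr K).natAbs ∣ 8 * W.conductorNorm ℤ := by
  haveI := numberField_divisionField_two W
  letI : Algebra K (W.divisionField 2) := ψ.toAlgebra
  have hdvd : NumberField.discr K ∣ NumberField.discr (W.divisionField 2) :=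
    NumberField.discr_dvd_discr K (W.divisionField 2)
  have hd0 : (NumberField.discr K).natAbs ≠ 0 := Int.natAbs_ne_zero.mpr (NumberField.discr_ne_zero K)
  have hN0 : W.conductorNorm ℤ ≠ 0 := (W.conductorNorm_pos_holds).ne'
  have hM : (8 : ℕ) * W.conductorNorm ℤ = 2 ^ 3 * W.conductorNorm ℤ := by norm_num
  rw [hM, ← Nat.factorization_prime_le_iff_dvd hd0 (by positivity)]
  intro p hp
  rw [Nat.factorization_mul (by positivity) hN0, Nat.factorization_pow,
    Nat.Prime.factorization Nat.prime_two]
  simp only [Finsupp.coe_add, Finsupp.coe_smul, Pi.add_apply, Pi.smul_apply, smul_eq_mul,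
    Finsupp.single_apply]
  rw [Nat.factorization_def _ hp]
  by_cases h2 : p = 2
  · subst h2
    have := padicValNat_two_discr_le_three K (by omega)
    simp only [if_true]
    omega
  simp only [show (2 : ℕ) ≠ p from fun h => h2 h.symm, if_false, mul_zero, zero_add]
  by_cases hpN : p ∣ W.conductorNorm ℤ
  · have hcap := padicValNat_discr_le_of_finrank_lt K hp (by have := hp.two_le; omega)
    rw [hK] at hcap
    have := hp.factorization_pos_of_dvd hN0 hpN
    omega
  · have hnd : ¬ (p : ℤ) ∣ NumberField.discr K := fun h =>
      not_dvd_discr_divisionField_two W hp h2 hpN (h.trans hdvd)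
    have : ¬ p ∣ (NumberField.discr K).natAbs := fun h => hnd (Int.natCast_dvd.mpr h)
    rw [padicValNat.eq_zero_of_not_dvd this]
    exact Nat.zero_le _

end Assembly

/-! ### §D. The item -/

open Summit.ABC.ABC.Theses.CubicResolventAllowance in
/-- **Item `ResolventDiscBounds` (stmt-ABC-22743) of route CubicResolventAllowance.** For an elliptic
curve `E/ℚ` with conductor `N`: a cubic number field `K` containing a root of the irreducible
2-division cubic has `|d_K| ≤ 1944·N²`, and a quadratic field containing an irrational root has
`|d_K| ≤ 8·N`. Proof: `K = ℚ(θ)` embeds in `ℚ(E[2])` (`exists_ringHom_divisionField_two`), so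
`d_K ∣ d_{ℚ(E[2])}`; `ℚ(E[2])` is unramified at odd `p ∤ N` (Néron–Ogg–Shafarevich,
`not_dvd_discr_divisionField_two`), and the valuation caps `v₂ ≤ 3`, `v₃ ≤ 5`, `v_p ≤ [K:ℚ]-1`
(Dedekind's different theorem, part I) give `|d_K| ∣ 2³·3⁵·N²` resp. `|d_K| ∣ 2³·N`. The line's payoff
is a class-window row under A-PS, NOT abc. [cite: SilvermanAEC2009, Thm. VII.7.1] -/
theorem resolventDiscBounds_proof : ResolventDiscBounds := by
  unfold ResolventDiscBounds
  refine ⟨fun W _ K _ _ hirr hfin hθ => ?_, fun W _ K _ _ hfin hθ => ?_⟩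
  · obtain ⟨θ, hθ⟩ := hθ
    -- `K = ℚ(θ)`: the minimal polynomial of `θ` is the (irreducible) 2-division cubic up to a unit
    have hint : IsIntegral ℚ θ := IsIntegral.of_finite ℚ θ
    have hdvd : minpoly ℚ θ ∣ W.twoTorsionPolynomial.toPoly := minpoly.dvd ℚ θ hθ
    have hassoc := (minpoly.irreducible hint).associated_of_dvd hirr hdvd
    have hdeg : (minpoly ℚ θ).natDegree = 3 := by
      rw [Polynomial.natDegree_eq_of_degree_eq (Polynomial.degree_eq_degree_of_associated hassoc)]
      exact Cubic.natDegree_of_a_ne_zero (by norm_num [WeierstrassCurve.twoTorsionPolynomial])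
    have hgen : IntermediateField.adjoin ℚ {θ} = ⊤ :=
      (Field.primitive_element_iff_minpoly_natDegree_eq ℚ θ).mpr (by rw [hdeg, hfin])
    obtain ⟨ψ⟩ := exists_ringHom_divisionField_two W K hθ hgen
    have h := natAbs_discr_dvd_of_cubic W K hfin ψ
    have hN0 : W.conductorNorm ℤ ≠ 0 := (W.conductorNorm_pos_holds).ne'
    have hle := Nat.le_of_dvd (by positivity) h
    have habs : |(NumberField.discr K : ℝ)| = ((NumberField.discr K).natAbs : ℝ) := by
      rw [Nat.cast_natAbs, Int.cast_abs]
    rw [habs]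
    exact_mod_cast hle
  · obtain ⟨θ, hθ, hirrat⟩ := hθ
    have hint : IsIntegral ℚ θ := IsIntegral.of_finite ℚ θ
    have hle2 : (minpoly ℚ θ).natDegree ≤ 2 := hfin ▸ minpoly.natDegree_le θ
    have hpos : 0 < (minpoly ℚ θ).natDegree := minpoly.natDegree_pos hint
    have hne1 : (minpoly ℚ θ).natDegree ≠ 1 := by
      rw [Ne, minpoly.natDegree_eq_one_iff]
      rintro ⟨q, hq⟩
      exact hirrat q hq.symm
    have hdeg : (minpoly ℚ θ).natDegree = 2 := by omega
    have hgen : IntermediateField.adjoin ℚ {θ} = ⊤ :=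
      (Field.primitive_element_iff_minpoly_natDegree_eq ℚ θ).mpr (by rw [hdeg, hfin])
    obtain ⟨ψ⟩ := exists_ringHom_divisionField_two W K hθ hgen
    have h := natAbs_discr_dvd_of_quadratic W K hfin ψ
    have hN0 : W.conductorNorm ℤ ≠ 0 := (W.conductorNorm_pos_holds).ne'
    have hle := Nat.le_of_dvd (by positivity) h
    have habs : |(NumberField.discr K : ℝ)| = ((NumberField.discr K).natAbs : ℝ) := by
      rw [Nat.cast_natAbs, Int.cast_abs]
    rw [habs]
    exact_mod_cast hle

end Summit.ABC.ABC.Theorems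

end
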